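import Summits.QuantumFields.YangMills.Theses.RevelationMartingale

/-!
# Route RevelationMartingale — the glue item `WindowTailOfMartingale` (stmt-QuantumFields-23085), proved

`PredictableHoeffding → SubGaussianRevelationL → MeanDeviationL → FirstExitWindow.FirstExitWindowTailL`:
Azuma–Hoeffding with the predictable variance proxy supplied by the revelation crux, centred by the mean bound,
with constants γ₁ = min, C = 1, N = 0, c = 1/(8·Cv) (θ² = g²·p(g)²).  Pure logic + real arithmetic; no summit and no
rung is proved here (the cruxes stmt-23082/23083 and the engine stmt-23084 remain hypotheses of the route).
[folklore]
-/

namespace Summit.QuantumFields.YangMills.Theorems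

open scoped BigOperators Topology Classical MeasureTheory
open Filter Set Function MeasureTheory
open Summit.QuantumFields.YangMills.Theses.RevelationMartingale


open Literature.MathematicalPhysics.QuantumFieldTheory.Balaban1983to89
open Literature.MathematicalPhysics.QuantumFieldTheory.Balaban1983to89.T3ContinuumYM3Torus
open scoped Matrix.Norms.L2Operator

/-- `|g - 1| ≤ 2` in the operator norm for `g ∈ SU(2)`. [folklore] -/
private theorem dist1_le_two (g : Matrix.specialUnitaryGroup (Fin 2) ℂ) : GaugeGroup.dist1 g ≤ 2 := by
  change UnitaryModel.opDist1 (Literature.MathematicalPhysics.QuantumLattice.fundamentalRep (Fin 2) g) ≤ 2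
  unfold UnitaryModel.opDist1
  have h1 : ‖(Literature.MathematicalPhysics.QuantumLattice.fundamentalRep (Fin 2) g : Matrix (Fin 2) (Fin 2) ℂ)‖ = 1 :=
    UnitaryModel.norm_of_mem_unitaryGroup (Literature.MathematicalPhysics.QuantumLattice.fundamentalRep_mem_unitaryGroup g)
  have h2 : ‖(1 : Matrix (Fin 2) (Fin 2) ℂ)‖ = 1 :=
    UnitaryModel.norm_of_mem_unitaryGroup (Submonoid.one_mem _)
  calc ‖Literature.MathematicalPhysics.QuantumLattice.fundamentalRep (Fin 2) g - 1‖
      ≤ ‖Literature.MathematicalPhysics.QuantumLattice.fundamentalRep (Fin 2) g‖ + ‖(1 : Matrix (Fin 2) (Fin 2) ℂ)‖ :=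
        norm_sub_le _ _
    _ = 2 := by rw [h1, h2]; norm_num

/-- The glue `WindowTailOfMartingale` holds: Azuma–Hoeffding with the predictable proxy, centring by the mean bound,
and `θ² = g²·p(g)²`. [folklore] -/
theorem revelationMartingale_windowTailOfMartingale_proof :
    Summit.QuantumFields.YangMills.Theses.RevelationMartingale.WindowTailOfMartingale := by
  intro hPH hSG hMD L b₀ p₀ b₂ hb₀ hp₀ hb₂
  obtain ⟨γP, Cv, hγP, hγP1, hCv, hP⟩ := hSG L b₀ p₀ b₂ hb₀ hp₀ hb₂
  obtain ⟨γM, hγM, hγM1, hM⟩ := hMD L b₀ p₀ hb₀ hp₀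
  refine ⟨min γP γM, 1, 1 / (8 * Cv), 0, lt_min hγP hγM, (min_le_left _ _).trans hγP1, by positivity, ?_⟩
  intro F γ hFL hγ hγ₁ K j hj hjK p
  obtain ⟨ℱ, n, σ, hbot, hfm, hσm, hσ0, hmgf, hvar⟩ :=
    hP F γ hFL hγ (hγ₁.trans (min_le_left _ _)) K j hj hjK p
  have hmean := hM F γ hFL hγ (hγ₁.trans (min_le_right _ _)) K j hj hjK p
  set μ := T3UnitScaleTilt.gibbsK F T3UnitLawDensityEML.ℰp γ K with hμ
  haveI : MeasureTheory.IsProbabilityMeasure μ :=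
    T3UnitScaleTilt.isProbabilityMeasure_gibbsK F T3UnitLawDensityEML.ℰp hγ.le K
  set g2 : ℝ := γ * ((F.L : ℝ)⁻¹) ^ (K - j) with hg2
  set θ : ℝ := T3UnitScaleTilt.θBal F.L γ b₀ p₀ (K - j) with hθ
  have hL1 : (1 : ℝ) < F.L := by exact_mod_cast F.hL.2
  have hLpos : (0 : ℝ) < F.L := by linarith
  have hg2pos : 0 < g2 := mul_pos hγ (pow_pos (inv_pos.mpr hLpos) _)
  have hg2le : g2 ≤ 1 := by
    have h1 : ((F.L : ℝ)⁻¹) ^ (K - j) ≤ 1 := pow_le_one₀ (inv_nonneg.mpr hLpos.le) (inv_le_one_of_one_le₀ hL1.le)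
    calc g2 = γ * ((F.L : ℝ)⁻¹) ^ (K - j) := rfl
      _ ≤ 1 * 1 := mul_le_mul (hγ₁.trans ((min_le_left _ _).trans hγP1)) h1 (pow_nonneg (inv_nonneg.mpr hLpos.le) _) zero_le_one
      _ = 1 := by ring
  have hsq : Real.sqrt g2 ≤ 1 := Real.sqrt_le_one.mpr hg2le |>.trans_eq rfl
  have hsqpos : 0 < Real.sqrt g2 := Real.sqrt_pos.mpr hg2pos
  have hpF : 0 < B10.pFun b₀ p₀ (Real.sqrt g2) := by
    unfold B10.pFun
    have hlog : 0 ≤ Real.log (Real.sqrt g2)⁻¹ := Real.log_nonneg ((one_le_inv₀ hsqpos).mpr hsq)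
    exact mul_pos hb₀ (Real.rpow_pos_of_pos (by linarith) _)
  have hθpos : 0 < θ := mul_pos hsqpos hpF
  have hθsq : θ ^ 2 = g2 * B10.pFun b₀ p₀ (Real.sqrt g2) ^ 2 := by
    rw [hθ, T3UnitScaleTilt.θBal, mul_pow, Real.sq_sqrt hg2pos.le]
  have hbound : ∀ U : GaugeField (F.P K) 0 (Matrix.specialUnitaryGroup (Fin 2) ℂ), |GaugeGroup.dist1 (GaugeField.plaqHol (Averaging.iter (fun i => BlockAveraging.blockAvg (P := F.P K) (j := i) T3UnitLawDensityEML.ℰp) j U) p)| ≤ 2 := fun U => by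
    rw [abs_of_nonneg (GaugeGroup.dist1_nonneg _)]; exact dist1_le_two _
  have key := hPH (GaugeField (F.P K) 0 (Matrix.specialUnitaryGroup (Fin 2) ℂ)) μ ℱ (fun U : GaugeField (F.P K) 0 (Matrix.specialUnitaryGroup (Fin 2) ℂ) => GaugeGroup.dist1 (GaugeField.plaqHol (Averaging.iter (fun i => BlockAveraging.blockAvg (P := F.P K) (j := i) T3UnitLawDensityEML.ℰp) j U) p)) σ n 2 (Cv * g2) (θ / 2) (by positivity) (by positivity)
    hbound hbot hfm hσm hσ0 hmgf

  have hmean' : ∫ x, GaugeGroup.dist1 (GaugeField.plaqHol (Averaging.iter (fun i => BlockAveraging.blockAvg (P := F.P K) (j := i) T3UnitLawDensityEML.ℰp) j x) p) ∂μ ≤ θ / 2 := hmean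
  have step1 : μ.real {U : GaugeField (F.P K) 0 (Matrix.specialUnitaryGroup (Fin 2) ℂ) | (∀ k, k < j → PlaqSmall (T3UnitScaleTilt.θBal F.L γ b₀ p₀ (K - k)) (Averaging.iter (fun i => BlockAveraging.blockAvg (P := F.P K) (j := i) T3UnitLawDensityEML.ℰp) k U)) ∧ PlaqSmall (T3UnitScaleTilt.θBal F.L γ b₂ p₀ (K - j)) (Averaging.iter (fun i => BlockAveraging.blockAvg (P := F.P K) (j := i) T3UnitLawDensityEML.ℰp) j U) ∧ θ ≤ GaugeGroup.dist1 (GaugeField.plaqHol (Averaging.iter (fun i => BlockAveraging.blockAvg (P := F.P K) (j := i) T3UnitLawDensityEML.ℰp) j U) p)} ≤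
      μ.real {U : GaugeField (F.P K) 0 (Matrix.specialUnitaryGroup (Fin 2) ℂ) | θ / 2 ≤ (fun U : GaugeField (F.P K) 0 (Matrix.specialUnitaryGroup (Fin 2) ℂ) => GaugeGroup.dist1 (GaugeField.plaqHol (Averaging.iter (fun i => BlockAveraging.blockAvg (P := F.P K) (j := i) T3UnitLawDensityEML.ℰp) j U) p)) U - ∫ x, (fun U : GaugeField (F.P K) 0 (Matrix.specialUnitaryGroup (Fin 2) ℂ) => GaugeGroup.dist1 (GaugeField.plaqHol (Averaging.iter (fun i => BlockAveraging.blockAvg (P := F.P K) (j := i) T3UnitLawDensityEML.ℰp) j U) p)) x ∂μ ∧ ∑ i ∈ Finset.range n, σ i U ≤ Cv * g2} := by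
    apply ENNReal.toReal_mono (measure_ne_top μ _)
    apply measure_mono_ae
    filter_upwards [hvar] with U hU
    intro hin
    change (∀ k, k < j → PlaqSmall (T3UnitScaleTilt.θBal F.L γ b₀ p₀ (K - k)) (Averaging.iter (fun i => BlockAveraging.blockAvg (P := F.P K) (j := i) T3UnitLawDensityEML.ℰp) k U)) ∧ PlaqSmall (T3UnitScaleTilt.θBal F.L γ b₂ p₀ (K - j)) (Averaging.iter (fun i => BlockAveraging.blockAvg (P := F.P K) (j := i) T3UnitLawDensityEML.ℰp) j U) ∧ θ ≤ GaugeGroup.dist1 (GaugeField.plaqHol (Averaging.iter (fun i => BlockAveraging.blockAvg (P := F.P K) (j := i) T3UnitLawDensityEML.ℰp) j U) p) at hin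
    change θ / 2 ≤ GaugeGroup.dist1 (GaugeField.plaqHol (Averaging.iter (fun i => BlockAveraging.blockAvg (P := F.P K) (j := i) T3UnitLawDensityEML.ℰp) j U) p) - ∫ x, GaugeGroup.dist1 (GaugeField.plaqHol (Averaging.iter (fun i => BlockAveraging.blockAvg (P := F.P K) (j := i) T3UnitLawDensityEML.ℰp) j x) p) ∂μ ∧ ∑ i ∈ Finset.range n, σ i U ≤ Cv * g2
    refine ⟨?_, hU ⟨hin.1, hin.2.1⟩⟩
    have h3 := hin.2.2
    linarith
  have step3 : Real.exp (-((θ / 2) ^ 2 / (2 * (Cv * g2)))) =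
      1 * (g2⁻¹) ^ 0 * Real.exp (-(1 / (8 * Cv) * B10.pFun b₀ p₀ (Real.sqrt g2) ^ 2)) := by
    rw [pow_zero, mul_one, one_mul]
    congr 1
    rw [show (θ / 2) ^ 2 = θ ^ 2 / 4 by ring, hθsq]
    field_simp
    ring
  exact step1.trans (key.trans step3.le)


end Summit.QuantumFields.YangMills.Theorems
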